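import Literature.NumberTheory.EllipticCurves.BhargavaShankarUpperSieveAssemblyProofs
import HarnessLib

/-!
# The weighted upper congruence count from the set version (Bhargava–Shankar, Thm 2.12 upper
# bound ⇒ its form for `[0,1]`-valued weights modulo `N`), and Cor. 1.2 from the set version

`Proofs` file (theorems only: no definitions, no named facts). Source: M. Bhargava, A. Shankar,
*Binary quartic forms having bounded invariants, and the boundedness of the average rank of
elliptic curves*, Ann. of Math. (2) 181 (2015) 191–242, published version (= `arXiv:1006.1002v3`):
Thm 2.12 (congruence conditions: "Suppose `S` is a subset of `V_ℤ` defined by congruence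
conditions modulo finitely many prime powers. Then
`N(S ∩ V_ℤ^{(i)}; X) = N(V_ℤ^{(i)}; X) ∏_p μ_p(S) + O(X^{3/4+ε})`") and §2.7, where it is used
for the weight `ψ'^Y = ∏_{p<Y} ψ'_p` ("it follows from Theorem 2.12 that
`limsup N_{ψ'}(V^{(i)};X)/X^{5/6} = lim N(V^{(i)};X)/X^{5/6} · ∏ ∫ψ'`"): a weight on `V_ℤ`
defined by congruence conditions modulo `N` takes finitely many values, and its level sets are
sets defined by congruence conditions modulo `N`.

`BhargavaShankarUpperSieveAssemblyProofs` (tree) reduces Cor. 1.2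
(`Literature.NumberTheory.EllipticCurves.averageRankLE_three_halves`) to the local integrals (F)
and the upper congruence count (D) for `GL₂(ℤ)`-invariant weights `Ψ : (ℤ/Nℤ)⁵ → [0,1]`. This
file performs the printed passage from sets to weights, so that (D) may be supplied in the form
in which Thm 2.12 is stated — for **sets**:

* **(D_set)**: for every modulus `N ≥ 1`, every set `S ⊆ (ℤ/Nℤ)⁵` of residues whose pull-back to
  `V_ℤ` is `GL₂(ℤ)`-invariant, and every `ε > 0`, for all large real `X`,
  `N((V_ℤ^{(0)} ∪ V_ℤ^{(2+)} ∪ V_ℤ^{(1)}) ∩ S̃; X) ≤ (#S/N⁵ · (8/27)ζ(2) + ε) X^{5/6}`, where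
  `S̃ = {f ∈ V_ℤ : f mod N ∈ S}` and `N(·; X) = gl2zClassCount` counts `GL₂(ℤ)`-orbits of
  irreducible forms of height `< X` (the upper half of Thm 2.12 summed over the types
  `i = 0, 2+, 1`, with `4/135 + 4/135 + 32/135 = 8/27` and `#S/N⁵ = ∏_p μ_p(S̃)`).

Results: `upperCongruenceCount_of_setCount` ((D_set) ⇒ (D), by decomposing `Ψ = Σ_c c·1_{Ψ = c}`
over its finitely many values) and **`averageRankLE_three_halves_of_upperCongruenceSetCount`**:
(D_set) ∧ (F) ⇒ Cor. 1.2.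

## References

* M. Bhargava, A. Shankar, Ann. of Math. (2) 181 (2015) 191–242, Thm 2.12 and §2.7 (proof of
  Thm 2.21), Cor. 1.2; published numbering. [cite: BhargavaShankarAnnals2015, Thm 2.12 and §2.7 proof of Thm 2.21 (published numbering)]
-/

noncomputable section

open scoped Classical Topology
open Filter Set MeasureTheory Finset

namespace Literature.NumberTheory.EllipticCurves

namespace BinaryQuartic

/-- The three types `V_ℤ^{(0)} ∪ V_ℤ^{(2+)} ∪ V_ℤ^{(1)}` consist of forms with `Δ ≠ 0` or definite,
so their orbit sets below any height are finite (reduction theory, `finite_gl2zOrbits_of_subset`).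
[cite: BhargavaShankarAnnals2015, Thm 2.1 (N(S;X) finite)] -/
theorem union_three_subset_disc_ne_zero_or_isDefinite :
    (fourRealRoots ∪ posDefinite ∪ twoRealRoots : Set (BinaryQuartic ℤ)) ⊆
      {f | f.disc ≠ 0 ∨ (f.map (Int.castRingHom ℝ)).IsDefinite} := by
  rintro f ((hf | hf) | hf)
  · exact Or.inl (ne_of_gt hf.1)
  · exact Or.inr (posDefinite_subset_noRealRoots hf)
  · exact Or.inl (ne_of_lt hf)

/-- **From the set count to the weighted count** (Thm 2.12, upper half, for sets defined by
congruence conditions modulo `N` ⇒ the same for `GL₂(ℤ)`-invariant weights `Ψ : (ℤ/Nℤ)⁵ → [0,1]`):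
`Σ_{O ∈ T} Ψ(O mod N) = Σ_c c · #{O ∈ T : Ψ = c} ≤ Σ_c c (#{Ψ = c}/N⁵ κ + ε') X^{5/6}
= (ν(Ψ) κ + ε' Σ_c c) X^{5/6}` over the finitely many values `c` of `Ψ`.
[cite: BhargavaShankarAnnals2015, Thm 2.12 and §2.7 proof of Thm 2.21 (N_{ψ'} from Thm 2.12; published numbering)] -/
theorem upperCongruenceCount_of_setCount
    (hDset : ∀ (N : ℕ) [NeZero N] (S : Finset (Fin 5 → ZMod N)),
      (∀ f g : BinaryQuartic ℤ, GL2ZEquiv f g →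
        ((fun j => ((g.coeffs j : ℤ) : ZMod N)) ∈ S ↔ (fun j => ((f.coeffs j : ℤ) : ZMod N)) ∈ S)) →
      ∀ ε : ℝ, 0 < ε → ∀ᶠ X : ℝ in atTop,
        (gl2zClassCount ((fourRealRoots ∪ posDefinite ∪ twoRealRoots) ∩
            {f : BinaryQuartic ℤ | (fun j => ((f.coeffs j : ℤ) : ZMod N)) ∈ S}) X : ℝ) ≤
          ((S.card : ℝ) / (N : ℝ) ^ 5 * (8 / 27 * (Real.pi ^ 2 / 6)) + ε) * X ^ (5 / 6 : ℝ))
    (N : ℕ) [NeZero N] (Ψ : (Fin 5 → ZMod N) → ℝ) (hΨ0 : ∀ r, 0 ≤ Ψ r) (hΨ1 : ∀ r, Ψ r ≤ 1)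
    (hΨinv : ∀ f g : BinaryQuartic ℤ, GL2ZEquiv f g →
      Ψ (fun j => ((g.coeffs j : ℤ) : ZMod N)) = Ψ (fun j => ((f.coeffs j : ℤ) : ZMod N)))
    {ε : ℝ} (hε : 0 < ε) :
    ∀ᶠ X : ℝ in atTop,
      ∀ (T : Finset (Set (BinaryQuartic ℤ))) (ρ : Set (BinaryQuartic ℤ) → BinaryQuartic ℤ),
        (↑T ⊆ gl2zOrbit '' {f : BinaryQuartic ℤ |
            f ∈ fourRealRoots ∪ posDefinite ∪ twoRealRoots ∧ f.IsIrreducible ∧ f.height < X}) →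
        (∀ O ∈ T, ρ O ∈ O) →
        ∑ O ∈ T, Ψ (fun j => (((ρ O).coeffs j : ℤ) : ZMod N)) ≤
          ((∑ r : Fin 5 → ZMod N, Ψ r) / (N : ℝ) ^ 5 * (8 / 27 * (Real.pi ^ 2 / 6)) + ε) *
            X ^ (5 / 6 : ℝ) := by
  set κ : ℝ := 8 / 27 * (Real.pi ^ 2 / 6) with hκ
  -- the values of `Ψ` and its level sets
  set vals : Finset ℝ := Finset.univ.image Ψ with hvals
  have hvals_pos : 0 < (vals.card : ℝ) := by
    have : vals.Nonempty := ⟨Ψ 0, Finset.mem_image_of_mem Ψ (Finset.mem_univ _)⟩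
    exact_mod_cast this.card_pos
  set ε' : ℝ := ε / vals.card with hε'
  have hε'pos : 0 < ε' := div_pos hε hvals_pos
  set Sc : ℝ → Finset (Fin 5 → ZMod N) := fun c => Finset.univ.filter fun r => Ψ r = c with hSc
  have hScinv : ∀ c, ∀ f g : BinaryQuartic ℤ, GL2ZEquiv f g →
      ((fun j => ((g.coeffs j : ℤ) : ZMod N)) ∈ Sc c ↔ (fun j => ((f.coeffs j : ℤ) : ZMod N)) ∈ Sc c) := by
    intro c f g hfg
    simp only [hSc, Finset.mem_filter, Finset.mem_univ, true_and, hΨinv f g hfg]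
  -- the set count for every level set, simultaneously
  have hall : ∀ᶠ X : ℝ in atTop, ∀ c ∈ vals,
      (gl2zClassCount ((fourRealRoots ∪ posDefinite ∪ twoRealRoots) ∩
          {f : BinaryQuartic ℤ | (fun j => ((f.coeffs j : ℤ) : ZMod N)) ∈ Sc c}) X : ℝ) ≤
        (((Sc c).card : ℝ) / (N : ℝ) ^ 5 * κ + ε') * X ^ (5 / 6 : ℝ) :=
    (Filter.eventually_all_finset vals).mpr fun c _ => hDset N (Sc c) (hScinv c) ε' hε'pos
  filter_upwards [hall, eventually_ge_atTop 0] with X hX hX0 T ρ hT hρ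
  have hXpow : 0 ≤ X ^ (5 / 6 : ℝ) := Real.rpow_nonneg hX0 _
  -- fibrewise decomposition of the weighted orbit sum
  set w : Set (BinaryQuartic ℤ) → ℝ := fun O => Ψ (fun j => (((ρ O).coeffs j : ℤ) : ZMod N)) with hw
  have hmaps : ∀ O ∈ T, w O ∈ vals := fun O _ => Finset.mem_image_of_mem Ψ (Finset.mem_univ _)
  have hfib : ∑ O ∈ T, w O = ∑ c ∈ vals, c * ((T.filter fun O => w O = c).card : ℝ) := by
    rw [← Finset.sum_fiberwise_of_maps_to' (g := w) hmaps (fun c => c)]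
    refine Finset.sum_congr rfl fun c _ => ?_
    rw [Finset.sum_const, nsmul_eq_mul, mul_comm]
  -- each fibre is a set of orbits of `R* ∩ S̃_c`
  have hcard : ∀ c ∈ vals, ((T.filter fun O => w O = c).card : ℝ) ≤
      (gl2zClassCount ((fourRealRoots ∪ posDefinite ∪ twoRealRoots) ∩
          {f : BinaryQuartic ℤ | (fun j => ((f.coeffs j : ℤ) : ZMod N)) ∈ Sc c}) X : ℝ) := by
    intro c _
    have hsub : (↑(T.filter fun O => w O = c) : Set (Set (BinaryQuartic ℤ))) ⊆
        gl2zOrbit '' {f : BinaryQuartic ℤ | f ∈ (fourRealRoots ∪ posDefinite ∪ twoRealRoots) ∩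
          {f : BinaryQuartic ℤ | (fun j => ((f.coeffs j : ℤ) : ZMod N)) ∈ Sc c} ∧
            f.IsIrreducible ∧ f.height < X} := by
      intro O hO
      rw [Finset.coe_filter, Set.mem_setOf_eq] at hO
      obtain ⟨hOT, hOc⟩ := hO
      obtain ⟨f, hf, rfl⟩ := hT hOT
      refine ⟨f, ⟨⟨hf.1, ?_⟩, hf.2.1, hf.2.2⟩, rfl⟩
      have hequiv : GL2ZEquiv f (ρ (gl2zOrbit f)) := hρ _ hOT
      simp only [Set.mem_setOf_eq, hSc, Finset.mem_filter, Finset.mem_univ, true_and]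
      rw [← hΨinv f _ hequiv]
      exact hOc
    have hfin := finite_gl2zOrbits_of_subset
      (S := (fourRealRoots ∪ posDefinite ∪ twoRealRoots) ∩
        {f : BinaryQuartic ℤ | (fun j => ((f.coeffs j : ℤ) : ZMod N)) ∈ Sc c})
      (fun f hf => union_three_subset_disc_ne_zero_or_isDefinite hf.1) X
    have h := Set.ncard_le_ncard hsub hfin
    rw [Set.ncard_coe_finset] at h
    unfold gl2zClassCount
    exact_mod_cast h
  -- `Σ_c c · #(Sc c) = Σ_r Ψ r` and `Σ_c c ≤ #vals`
  have hsumval : ∑ c ∈ vals, c * ((Sc c).card : ℝ) = ∑ r, Ψ r := by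
    rw [← Finset.sum_fiberwise_of_maps_to' (s := Finset.univ) (t := vals) (g := Ψ)
      (fun r _ => Finset.mem_image_of_mem Ψ (Finset.mem_univ r)) (fun c => c)]
    refine Finset.sum_congr rfl fun c _ => ?_
    rw [Finset.sum_const, nsmul_eq_mul, mul_comm]
  have hvals_le : ∀ c ∈ vals, 0 ≤ c ∧ c ≤ 1 := by
    intro c hc
    rw [hvals, Finset.mem_image] at hc
    obtain ⟨r, -, rfl⟩ := hc
    exact ⟨hΨ0 r, hΨ1 r⟩
  have hsumc : ∑ c ∈ vals, c * ε' ≤ ε := by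
    calc ∑ c ∈ vals, c * ε' ≤ ∑ _c ∈ vals, 1 * ε' :=
          Finset.sum_le_sum fun c hc => mul_le_mul_of_nonneg_right (hvals_le c hc).2 hε'pos.le
      _ = ε := by
          rw [Finset.sum_const, nsmul_eq_mul, hε']
          field_simp
  -- assemble
  calc ∑ O ∈ T, w O = ∑ c ∈ vals, c * ((T.filter fun O => w O = c).card : ℝ) := hfib
    _ ≤ ∑ c ∈ vals, c * ((((Sc c).card : ℝ) / (N : ℝ) ^ 5 * κ + ε') * X ^ (5 / 6 : ℝ)) :=
        Finset.sum_le_sum fun c hc => mul_le_mul_of_nonneg_left ((hcard c hc).trans (hX c hc))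
          (hvals_le c hc).1
    _ = (∑ c ∈ vals, (c * ((Sc c).card : ℝ) / (N : ℝ) ^ 5 * κ + c * ε')) * X ^ (5 / 6 : ℝ) := by
        rw [Finset.sum_mul]
        refine Finset.sum_congr rfl fun c _ => ?_
        ring
    _ = ((∑ c ∈ vals, c * ((Sc c).card : ℝ)) / (N : ℝ) ^ 5 * κ + ∑ c ∈ vals, c * ε') *
          X ^ (5 / 6 : ℝ) := by
        rw [Finset.sum_add_distrib, Finset.sum_div, Finset.sum_mul]
    _ ≤ ((∑ r, Ψ r) / (N : ℝ) ^ 5 * κ + ε) * X ^ (5 / 6 : ℝ) := by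
        rw [hsumval]
        gcongr

/-- **Bhargava–Shankar, Cor. 1.2 (`averageRankLE_three_halves`) from the upper half of Thm 2.12
for sets and the local integrals (F).** With (D_set) as in the module docstring — the upper
bound of Thm 2.12 for sets of residues modulo `N` with `GL₂(ℤ)`-invariant pull-back, summed over
the types `V_ℤ^{(0)}, V_ℤ^{(2+)}, V_ℤ^{(1)}` — and (F): `∫ φ_p dμ_p = |2¹⁰/3³|_p M_p(V,F)` for every
prime `p`, the `limsup` of the average rank of elliptic curves over `ℚ` ordered by height is at
most `3/2`. [cite: BhargavaShankarAnnals2015, Cor. 1.2 with Thm 2.12 and Prop. 3.13 (published numbering)] -/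
theorem averageRankLE_three_halves_of_upperCongruenceSetCount
    (hDset : ∀ (N : ℕ) [NeZero N] (S : Finset (Fin 5 → ZMod N)),
      (∀ f g : BinaryQuartic ℤ, GL2ZEquiv f g →
        ((fun j => ((g.coeffs j : ℤ) : ZMod N)) ∈ S ↔ (fun j => ((f.coeffs j : ℤ) : ZMod N)) ∈ S)) →
      ∀ ε : ℝ, 0 < ε → ∀ᶠ X : ℝ in atTop,
        (gl2zClassCount ((fourRealRoots ∪ posDefinite ∪ twoRealRoots) ∩
            {f : BinaryQuartic ℤ | (fun j => ((f.coeffs j : ℤ) : ZMod N)) ∈ S}) X : ℝ) ≤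
          ((S.card : ℝ) / (N : ℝ) ^ 5 * (8 / 27 * (Real.pi ^ 2 / 6)) + ε) * X ^ (5 / 6 : ℝ))
    (hF : ∀ (p : ℕ) [Fact p.Prime],
      ∫ f : BinaryQuartic ℤ_[p],
          (if (f.map PadicInt.Coe.ringHom).IsSoluble ∧
              (∃ IJ ∈ invariantPairsAdic p, f.I = 2 ^ 4 * IJ.1 ∧ f.J = 2 ^ 6 * IJ.2)
            then (1 : ℝ) / localWeight f else 0) =
        ((padicNorm p (2 ^ 10 / 3 ^ 3) : ℚ) : ℝ) * localMassV p) :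
    averageRankLE_three_halves :=
  averageRankLE_three_halves_of_upperCongruenceCount
    (fun N _ Ψ hΨ0 hΨ1 hΨinv _ hε => upperCongruenceCount_of_setCount hDset N Ψ hΨ0 hΨ1 hΨinv hε) hF

end BinaryQuartic

end Literature.NumberTheory.EllipticCurves

end
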